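import Literature.NumberTheory.Weil1964.AdelicThetaTensorRep
import Literature.Analysis.SegalBargmann.SchwartzCarrierTransport
import Literature.Analysis.SegalBargmann.SchwartzUnitarySymplectic
import HarnessLib

/-!
# The archimedean Weil datum: the hypothesis structure of the term `ω_∞` on Schwartz space, its rigidity, its compact normal form, and the junction with the theta majorants of `ω_∞ ⊗ ω_f` (Folland 1989 §4.2; MVW Chap. 2 II.1; Weil 1964 n° 41)

Topic `NumberTheory/Weil1964`; namespace `Literature.NumberTheory.Weil1964`.  The archimedean component
`ω_∞` of an adelic Weil (oscillator) representation acts on the Schwartz space `𝓢(X_∞)` of the archimedean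
points of a Lagrangian.  In the tree it is a PARAMETER of its consumers (`AdelicSchwartzBruhatTensor.adelicRep ω_∞ ω_f`,
`AdelicThetaTensorRep`, `ThetaDualPairDatum.adelicOfDualPairRep`), never a chosen witness.  This file fixes the
ONE hypothesis structure under which such a parameter is "the" oscillator representation of `G_∞` attached to a
homomorphism `ι𝕎 : G_∞ →* Sp(ℝ^σ × ℝ^σ)` — exactly the properties the consumers use, and nothing more:

* §1 **`IsArchWeilDatum ι𝕎 ω`** for `ω : Representation ℂ G_∞ 𝓢(ℝ^σ, ℂ)`: (w1) the orbit maps `g ↦ ω(g)f` are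
  continuous into the Fréchet space `𝓢` (strong continuity); (w2) Heisenberg covariance over `ι𝕎`,
  `ω(g) ρ(p,q) = ρ(ι𝕎(g)(p,q)) ω(g)` on `𝓢` for Folland's operators `ρ(p,q)` (T11 `rhoS`, (1.25)) — i.e. MVW's
  condition (A) for every `(ι𝕎 g, ω g)` (`IsArchWeilDatum.implements`, `.mem_MpPsi`: the pair lies in
  `MpPsi (schwartzSchrodinger σ)`, T12); (w2′) every `ω(g)` is the restriction to `𝓢` of a unitary operator of
  `L²(ℝ^σ)` (`LiftsTo`, T11);
* §2 consequences in MVW's language: the datum IS a splitting homomorphism `G_∞ →* MpPsi ρ_∞` of the extension (B)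
  over `ι𝕎` (`IsArchWeilDatum.toMpPsi`, `proj_toMpPsi`, `toOp_toMpPsi`); restriction along continuous
  homomorphisms (`IsArchWeilDatum.comp`);
* §3 the unitary lifts form a unitary representation of `G_∞` on `L²` (`exists_liftFamily_of`: uniqueness of lifts,
  T11 `LiftsTo.unique`), strongly continuous on `L²` as soon as (w1) holds (`continuous_lift_apply`, density of `𝓢`);
* §4 **rigidity**: a datum is determined by `ι𝕎` up to a unitary character of `G_∞` — any second covariant family with
  unitary lifts is `χ • ω` for a homomorphism `χ : G_∞ →* S¹` (`exists_character`), continuous when both are data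
  (`exists_continuous_character`) — Folland (4.23) and the Schur remark, through T9/T11;
* §5 **compact normal form**: along any `κ : K →* G_∞` whose image acts on phase space through unitary matrices
  (`ι𝕎 (κ k) = realifySp (ι_K k)`, T13), `ω(κ k)` is, inside `L²`, the tree's oscillator action `schrodingerU (ι_K k)`
  twisted by a continuous unitary character of `K` (`exists_vacChar`) — Folland Prop. (4.39) through T4/T13;
* §6 other carriers: a representation `ω_D` on `𝓢(D, ℂ)` for any finite-dimensional real carrier `D` with a linear
  identification `e : D ≃L[ℝ] ℝ^σ` is a datum through `repTransport e` (T14); (w1) on `D` and on `ℝ^σ` are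
  equivalent (`of_carrier`, `continuous_apply_carrier`);
* §7 **junction with the theta kernel**: for `ω_∞` on `𝓢((F ⊗ ℝ)ⁿ)` a datum (through any `e`) and `ω_f` smooth,
  `ω_∞ ⊗ ω_f` has theta majorants and its theta kernel is continuous (`IsArchWeilDatum.hasThetaMajorants_adelicRep`,
  `…_comp`, `continuous_thetaDistLM_adelicRep`) — the hypothesis `hω` of `ThetaDualPairDatum.adelicOfDualPairRep`
  (Weil 1964, n° 41, Théorème 6, conclusion 1, for representations given place by place);
* §8 **the sign of `ψ_∞`**: the operators `ρ(p,−q) = conj-character Heisenberg operators` (`rhoMul_neg_right`)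
  belong to `ψ_∞(x) = e^{−2πix}` (Tate's archimedean character, the tree's `sdChar`); covariance for them over `ι𝕎`
  is covariance for `ρ(p,q)` over the conjugate `spConj ∘ ι𝕎` by the anti-symplectic involution `(p,q) ↦ (p,−q)`
  (`qFlip`, `spConj`, `isPhaseCovariantS_spConj_iff`), so a datum for `e^{−2πix}` over `ι𝕎` is
  `IsArchWeilDatum (spConj.comp ι𝕎) ω`.

Everything is PROVED; no cited statement is used as a hypothesis.  The structure is a HYPOTHESIS on a parameter:
non-vacuity (the existence of a datum for the real points of a reductive dual pair) is a separate statement, not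
part of this file.

Use (pub-hodgecm model cell, node W2-∞ (γ)): consumers quantify over `(ω_∞) (hW : IsArchWeilDatum ι𝕎 (repTransport e ω_∞))`;
§7 discharges `hω` of the theta-kernel datum, §4/§5 pin `ω_∞` on `K_∞ × K′_∞` and against any explicit covariant
family, §8 calibrates the additive character against the finite places.

## References

* [Folland1989] G. B. Folland, *Harmonic Analysis in Phase Space*, Princeton University Press, 1989, §1.3 (1.25),
  §4.2 (4.23) and the Schur remark following it, Prop. (4.39).
* [MoeglinVignerasWaldspurger1987] C. Mœglin, M.-F. Vignéras, J.-L. Waldspurger, *Correspondances de Howe sur un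
  corps p-adique*, LNM 1291, Springer, 1987, Chap. 2 II.1 (A), (B).
* [Weil1964] A. Weil, Sur certains groupes d'opérateurs unitaires, Acta Math. 111 (1964), n° 41, Théorème 6 p. 193.
-/

set_option autoImplicit false

noncomputable section

open MeasureTheory Complex SchwartzMap
open scoped InnerProductSpace ComplexConjugate Real FourierTransform

namespace Literature.NumberTheory.Weil1964

open Literature.Analysis.SegalBargmann Literature.RepresentationTheory.HeisenbergGroup

variable {σ : Type*} [Fintype σ] [DecidableEq σ]
variable {Ginf : Type*} [Group Ginf] [TopologicalSpace Ginf]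

local notation "L2R" σ => Lp ℂ 2 (volume : Measure (σ → ℝ))
local notation "SR" σ => SchwartzMap (σ → ℝ) ℂ
local notation "PV" σ => (σ → ℝ) × (σ → ℝ)
local notation "SpR" σ => symplecticGroup (polar (dotPairing σ))

/-! ## 0. A representation as a homomorphism into `GL` -/

section RepGL

variable {S : Type*} [AddCommGroup S] [Module ℂ S]

omit [TopologicalSpace Ginf] in
/-- A representation `ω` of a group as a homomorphism `g ↦ ω g` into the linear AUTOMORPHISMS of its space
(Mathlib's `MonoidHom.toHomUnits` followed by `LinearMap.GeneralLinearGroup.generalLinearEquiv`). [folklore] -/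
def repGL (ω : Representation ℂ Ginf S) : Ginf →* (S ≃ₗ[ℂ] S) :=
  (LinearMap.GeneralLinearGroup.generalLinearEquiv ℂ S).toMonoidHom.comp ω.toHomUnits

omit [TopologicalSpace Ginf] in
/-- `repGL ω g` acts as `ω g`. [folklore] -/
@[simp] theorem repGL_apply (ω : Representation ℂ Ginf S) (g : Ginf) (f : S) : repGL ω g f = ω g f := rfl

omit [TopologicalSpace Ginf] in
/-- As a linear map `repGL ω g` is `ω g`. [folklore] -/
@[simp] theorem coe_repGL (ω : Representation ℂ Ginf S) (g : Ginf) :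
    ((repGL ω g : S ≃ₗ[ℂ] S) : S →ₗ[ℂ] S) = ω g :=
  LinearMap.ext fun _ => rfl

end RepGL

/-! ## 1. The hypothesis structure -/

/-- **The archimedean Weil datum.**  A representation `ω` of `G_∞` on `𝓢(ℝ^σ, ℂ)` is an oscillator (Weil)
representation attached to `ι𝕎 : G_∞ →* Sp(ℝ^σ × ℝ^σ)` when
(w1) its orbit maps are continuous into `𝓢`;
(w2) it is Heisenberg-covariant over `ι𝕎`: `ω(g) ρ(p,q) = ρ(ι𝕎(g)(p,q)) ω(g)` (Folland (4.23); = MVW's condition (A)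
for `(ι𝕎 g, ω g)` through Weil's section, `IsArchWeilDatum.implements`);
(w2′) each `ω(g)` is the restriction to `𝓢` of a unitary operator of `L²(ℝ^σ)`.
[cite: Folland1989, §4.2, (4.23); MoeglinVignerasWaldspurger1987, Chap. 2 II.1 (A)] -/
structure IsArchWeilDatum (ι𝕎 : Ginf →* SpR σ) (ω : Representation ℂ Ginf (SR σ)) : Prop where
  /-- (w1) strong continuity on the Fréchet space `𝓢(ℝ^σ)`. -/
  continuous_apply : ∀ f : SR σ, Continuous fun g => ω g f
  /-- (w2) Heisenberg covariance over `ι𝕎` (Folland (4.23) for the operators `rhoS p q`). -/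
  covariant : IsPhaseCovariantS (fun g => ⇑((ι𝕎 g).1 : (PV σ) ≃ₗ[ℝ] PV σ)) (fun g => ω g)
  /-- (w2′) every `ω g` is the restriction of a unitary operator of `L²(ℝ^σ)`. -/
  exists_lift : ∀ g, ∃ U : (L2R σ) ≃ₗᵢ[ℂ] L2R σ,
    LiftsTo (ω g) ((U.toContinuousLinearEquiv : (L2R σ) ≃L[ℂ] L2R σ) : (L2R σ) →L[ℂ] L2R σ)

namespace IsArchWeilDatum

variable {ι𝕎 : Ginf →* SpR σ} {ω : Representation ℂ Ginf (SR σ)}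

/-! ## 2. MVW's language: condition (A), membership in `MpPsi`, the splitting homomorphism -/

omit [DecidableEq σ] in
/-- (w2) is MVW's condition (A) for `(ι𝕎 g, ω g)` through Weil's section `ofSymplectic`.
[cite: MoeglinVignerasWaldspurger1987, Chap. 2 II.1 (A)] -/
theorem implements (hW : IsArchWeilDatum ι𝕎 ω) (g : Ginf) :
    Implements (schwartzSchrodinger σ) (ofSymplectic _ (ι𝕎 g)) (repGL ω g) := by
  have h : IsPhaseCovariantS (fun g => ⇑((ι𝕎 g).1 : (PV σ) ≃ₗ[ℝ] PV σ))
      (fun g => ((repGL ω g : (SR σ) ≃ₗ[ℂ] SR σ) : (SR σ) →ₗ[ℂ] SR σ)) := by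
    simpa only [coe_repGL] using hW.covariant
  exact (implements_family_iff σ (fun g => ι𝕎 g) (fun g => repGL ω g)).2 h g

omit [DecidableEq σ] in
/-- `(ι𝕎 g, ω g) ∈ MpPsi ρ_∞` for the Schrödinger model on `𝓢(ℝ^σ)`. [cite: MoeglinVignerasWaldspurger1987, Chap. 2 II.1 (A)] -/
theorem mem_MpPsi (hW : IsArchWeilDatum ι𝕎 ω) (g : Ginf) :
    (ι𝕎 g, repGL ω g) ∈ MpPsi (schwartzSchrodinger σ) :=
  (Literature.RepresentationTheory.HeisenbergGroup.mem_MpPsi _ _).2 (hW.implements g)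

/-- **The datum as a splitting of MVW's extension (B) over `ι𝕎`**: `g ↦ (ι𝕎 g, ω g) : G_∞ →* MpPsi ρ_∞`.
[cite: MoeglinVignerasWaldspurger1987, Chap. 2 II.1 (B)] -/
def toMpPsi (hW : IsArchWeilDatum ι𝕎 ω) : Ginf →* MpPsi (schwartzSchrodinger σ) :=
  (ι𝕎.prod (repGL ω)).codRestrict _ fun g => hW.mem_MpPsi g

omit [DecidableEq σ] in
/-- `proj ∘ toMpPsi = ι𝕎`. [cite: MoeglinVignerasWaldspurger1987, Chap. 2 II.1 (B)] -/
@[simp] theorem proj_toMpPsi (hW : IsArchWeilDatum ι𝕎 ω) (g : Ginf) :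
    MpPsi.proj _ (hW.toMpPsi g) = ι𝕎 g := rfl

omit [DecidableEq σ] in
/-- `toOp ∘ toMpPsi = repGL ω`. [cite: MoeglinVignerasWaldspurger1987, Chap. 2 II.1 (A)] -/
@[simp] theorem toOp_toMpPsi (hW : IsArchWeilDatum ι𝕎 ω) (g : Ginf) :
    MpPsi.toOp _ (hW.toMpPsi g) = repGL ω g := rfl

omit [DecidableEq σ] in
/-- As homomorphisms: `proj.comp toMpPsi = ι𝕎`. [cite: MoeglinVignerasWaldspurger1987, Chap. 2 II.1 (B)] -/
theorem proj_comp_toMpPsi (hW : IsArchWeilDatum ι𝕎 ω) : (MpPsi.proj _).comp hW.toMpPsi = ι𝕎 :=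
  MonoidHom.ext fun _ => rfl

omit [DecidableEq σ] in
/-- **Restriction / pull-back** along a continuous homomorphism `φ : H →* G_∞`. [folklore] -/
theorem comp (hW : IsArchWeilDatum ι𝕎 ω) {H : Type*} [Group H] [TopologicalSpace H] (φ : H →* Ginf)
    (hφ : Continuous φ) : IsArchWeilDatum (ι𝕎.comp φ) (ω.comp φ) where
  continuous_apply f := (hW.continuous_apply f).comp hφ
  covariant h p q f := hW.covariant (φ h) p q f
  exists_lift h := hW.exists_lift (φ h)

end IsArchWeilDatum

/-! ## 3. The unitary lifts form a strongly continuous unitary representation on `L²` -/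

omit [TopologicalSpace Ginf] [DecidableEq σ] in
/-- **The unitary lifts of a representation on `𝓢` form a unitary representation on `L²`**: if every `ω g`
lifts to some unitary, the lifts are unique (density of `𝓢`), hence multiplicative with `U_1 = 1`. [folklore] -/
theorem exists_liftFamily_of {ω : Representation ℂ Ginf (SR σ)}
    (h : ∀ g, ∃ U : (L2R σ) ≃ₗᵢ[ℂ] L2R σ,
      LiftsTo (ω g) ((U.toContinuousLinearEquiv : (L2R σ) ≃L[ℂ] L2R σ) : (L2R σ) →L[ℂ] L2R σ)) :
    ∃ U : Ginf → ((L2R σ) ≃ₗᵢ[ℂ] L2R σ), (∀ g, LiftsTo (ω g) (liftCLM U g)) ∧ (∀ f : L2R σ, U 1 f = f) ∧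
      ∀ (g g' : Ginf) (f : L2R σ), U (g * g') f = U g (U g' f) := by
  choose U hU using h
  refine ⟨U, hU, fun f => ?_, fun g g' f => ?_⟩
  · have h1 : LiftsTo (ω 1) (ContinuousLinearMap.id ℂ (L2R σ)) := fun f => by
      rw [map_one]
      rfl
    simpa using congrArg (fun T : (L2R σ) →L[ℂ] L2R σ => T f) ((hU 1).unique h1)
  · have h2 : LiftsTo (ω (g * g')) ((liftCLM U g).comp (liftCLM U g')) := by
      rw [map_mul]
      exact (hU g).comp (hU g')
    simpa using congrArg (fun T : (L2R σ) →L[ℂ] L2R σ => T f) ((hU (g * g')).unique h2)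

omit [DecidableEq σ] in
/-- **Strong continuity on `L²` from strong continuity on `𝓢`**: the lifts `g ↦ U_g f` are continuous for every
`f ∈ L²` (they are so for `f ∈ 𝓢`, `𝓢` is dense, and the `U_g` are isometries). [folklore] -/
theorem continuous_lift_apply {ω : Representation ℂ Ginf (SR σ)} {U : Ginf → ((L2R σ) ≃ₗᵢ[ℂ] L2R σ)}
    (hc : ∀ f : SR σ, Continuous fun g => ω g f) (hU : ∀ g, LiftsTo (ω g) (liftCLM U g)) (f : L2R σ) :
    Continuous fun g => U g f := by
  refine continuous_of_uniform_approx_of_continuous fun u hu => ?_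
  obtain ⟨ε, hε, hεu⟩ := Metric.mem_uniformity_dist.mp hu
  obtain ⟨φ, hφ⟩ := denseRange_toL2.exists_dist_lt f hε
  refine ⟨fun g => U g (toL2 φ), ?_, fun g => hεu ?_⟩
  · have h1 : (fun g => U g (toL2 φ)) = fun g => toL2 (ω g φ) := by
      funext g
      have := hU g φ
      rw [liftCLM_apply] at this
      exact this.symm
    rw [h1]
    exact toL2.continuous.comp (hc φ)
  · rw [dist_eq_norm, ← map_sub, LinearIsometryEquiv.norm_map, ← dist_eq_norm]
    exact hφ

namespace IsArchWeilDatum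

variable {ι𝕎 : Ginf →* SpR σ} {ω ω' : Representation ℂ Ginf (SR σ)}

omit [DecidableEq σ] in
/-- The lifts of a datum: a unitary representation of `G_∞` on `L²(ℝ^σ)`, Heisenberg-covariant over `ι𝕎`, strongly
continuous, restricting to `ω` on `𝓢`. [folklore] -/
theorem exists_liftFamily (hW : IsArchWeilDatum ι𝕎 ω) :
    ∃ U : Ginf → ((L2R σ) ≃ₗᵢ[ℂ] L2R σ), (∀ g, LiftsTo (ω g) (liftCLM U g)) ∧ (∀ f : L2R σ, U 1 f = f) ∧
      (∀ (g g' : Ginf) (f : L2R σ), U (g * g') f = U g (U g' f)) ∧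
      IsPhaseCovariant (fun g => ⇑((ι𝕎 g).1 : (PV σ) ≃ₗ[ℝ] PV σ)) U ∧ ∀ f : L2R σ, Continuous fun g => U g f := by
  obtain ⟨U, hU, hU1, hUm⟩ := exists_liftFamily_of hW.exists_lift
  exact ⟨U, hU, hU1, hUm, hW.covariant.lift hU, continuous_lift_apply hW.continuous_apply hU⟩

/-! ## 4. Rigidity: a datum is determined by `ι𝕎` up to a unitary character -/

/-- **Rigidity.**  Any family `ω′` on `𝓢`, Heisenberg-covariant over the SAME `ι𝕎` and with unitary lifts, is
the datum twisted by a unitary character: `ω′(g) f = χ(g) • ω(g) f`, `χ : G_∞ →* S¹`.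
[cite: Folland1989, §4.2, (4.23) and the Schur remark following it] -/
theorem exists_character (hW : IsArchWeilDatum ι𝕎 ω)
    (hcov' : IsPhaseCovariantS (fun g => ⇑((ι𝕎 g).1 : (PV σ) ≃ₗ[ℝ] PV σ)) (fun g => ω' g))
    (hlift' : ∀ g, ∃ U : (L2R σ) ≃ₗᵢ[ℂ] L2R σ,
      LiftsTo (ω' g) ((U.toContinuousLinearEquiv : (L2R σ) ≃L[ℂ] L2R σ) : (L2R σ) →L[ℂ] L2R σ)) :
    ∃ χ : Ginf →* Circle, ∀ (g : Ginf) (f : SR σ), ω' g f = ((χ g : Circle) : ℂ) • ω g f := by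
  obtain ⟨U, hU, hU1, hUm⟩ := exists_liftFamily_of hW.exists_lift
  obtain ⟨U', hU', hU1', hUm'⟩ := exists_liftFamily_of hlift'
  exact ⟨relChar (hW.covariant.lift hU) (hcov'.lift hU') hU1 hU1' hUm hUm',
    fun g f => hW.covariant.eq_relChar_smul hcov' hU hU' hU1 hU1' hUm hUm' g f⟩

/-- **Two data over the same `ι𝕎` differ by a CONTINUOUS unitary character of `G_∞`.**
[cite: Folland1989, §4.2, (4.23) and the Schur remark following it] -/
theorem exists_continuous_character (hW : IsArchWeilDatum ι𝕎 ω) (hW' : IsArchWeilDatum ι𝕎 ω') :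
    ∃ χ : Ginf →* Circle, Continuous χ ∧ ∀ (g : Ginf) (f : SR σ), ω' g f = ((χ g : Circle) : ℂ) • ω g f := by
  obtain ⟨U, hU, hU1, hUm⟩ := exists_liftFamily_of hW.exists_lift
  obtain ⟨U', hU', hU1', hUm'⟩ := exists_liftFamily_of hW'.exists_lift
  exact ⟨relChar (hW.covariant.lift hU) (hW'.covariant.lift hU') hU1 hU1' hUm hUm',
    continuous_relChar _ _ hU1 hU1' hUm hUm' (continuous_lift_apply hW.continuous_apply hU vacL2)
      (continuous_lift_apply hW'.continuous_apply hU' vacL2),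
    fun g f => hW.covariant.eq_relChar_smul hW'.covariant hU hU' hU1 hU1' hUm hUm' g f⟩

/-! ## 5. Compact normal form -/

/-- **Compact normal form.**  Along `κ : K →* G_∞` (continuous) acting on phase space through unitary matrices,
`ι𝕎 (κ k) = realifySp (ι_K k)`, the datum is the tree's oscillator action of `U(σ)` twisted by a continuous unitary
character of `K`: `toL2 (ω(κ k) f) = χ(k) • schrodingerU (ι_K k) (toL2 f)`. [cite: Folland1989, Prop. (4.39)] -/
theorem exists_vacChar (hW : IsArchWeilDatum ι𝕎 ω) {K : Type*} [Group K] [TopologicalSpace K] (κ : K →* Ginf)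
    (hκ : Continuous κ) (ιK : K →* Matrix.unitaryGroup σ ℂ) (hcomp : ∀ k, ι𝕎 (κ k) = realifySp σ (ιK k)) :
    ∃ χ : K →* Circle, Continuous χ ∧
      ∀ (k : K) (f : SR σ), toL2 (ω (κ k) f) = ((χ k : Circle) : ℂ) • schrodingerU (ιK k) (toL2 f) := by
  obtain ⟨U, hU, hU1, hUm⟩ := exists_liftFamily_of hW.exists_lift
  have hS : IsRhoCovariantS (fun k => ιK k) (fun k => ω (κ k)) := by
    intro k p q f
    have h1 := hW.covariant (κ k) p q f
    dsimp only at h1 ⊢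
    rw [hcomp k, coe_realifySp] at h1
    exact h1
  have hUK : ∀ k, LiftsTo (ω (κ k)) (liftCLM (fun k => U (κ k)) k) := fun k => hU (κ k)
  have hω : IsRhoCovariant (fun k => ιK k) (fun k => U (κ k)) := hS.lift hUK
  have h1 : ∀ f : L2R σ, (fun k => U (κ k)) 1 f = f := fun f => by
    show U (κ 1) f = f
    rw [map_one, hU1]
  have hm : ∀ (k k' : K) (f : L2R σ), (fun k => U (κ k)) (k * k') f = (fun k => U (κ k)) k ((fun k => U (κ k)) k' f) :=
    fun k k' f => by
    show U (κ (k * k')) f = U (κ k) (U (κ k') f)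
    rw [map_mul, hUm]
  refine ⟨vacChar hω h1 hm, continuous_vacChar hω h1 hm ?_, fun k f => ?_⟩
  · exact (continuous_lift_apply hW.continuous_apply hU vacL2).comp hκ
  · rw [coe_vacChar]
    exact hS.toL2_apply hUK k f

end IsArchWeilDatum

/-! ## 6. Other carriers: `𝓢(D, ℂ)` along `e : D ≃L[ℝ] ℝ^σ` -/

section Carrier

variable {D : Type*} [NormedAddCommGroup D] [NormedSpace ℝ D]

omit [DecidableEq σ] in
/-- **A datum on another carrier.**  A representation `ω_D` on `𝓢(D, ℂ)` with continuous orbit maps, covariant for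
the transported Heisenberg operators `rhoSD e` over `ι𝕎`, whose transported operators lift to unitaries, is a
datum through `repTransport e`. [folklore] -/
theorem IsArchWeilDatum.of_carrier (e : D ≃L[ℝ] (σ → ℝ)) {ι𝕎 : Ginf →* SpR σ}
    {ωD : Representation ℂ Ginf (SchwartzMap D ℂ)} (h1 : ∀ Φ : SchwartzMap D ℂ, Continuous fun g => ωD g Φ)
    (h2 : IsPhaseCovariantSD e (fun g => ⇑((ι𝕎 g).1 : (PV σ) ≃ₗ[ℝ] PV σ)) (fun g => ωD g))
    (h3 : ∀ g, ∃ U : (L2R σ) ≃ₗᵢ[ℂ] L2R σ,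
      LiftsTo (opTransport e (ωD g)) ((U.toContinuousLinearEquiv : (L2R σ) ≃L[ℂ] L2R σ) : (L2R σ) →L[ℂ] L2R σ)) :
    IsArchWeilDatum ι𝕎 (repTransport e ωD) where
  continuous_apply f := continuous_opTransport_apply e h1 f
  covariant := (isPhaseCovariantS_opTransport_iff e _ _).2 h2
  exists_lift := h3

omit [DecidableEq σ] in
/-- (w1) descends to the original carrier: `g ↦ ω_D(g)Φ` is continuous into `𝓢(D)`. [folklore] -/
theorem IsArchWeilDatum.continuous_apply_carrier (e : D ≃L[ℝ] (σ → ℝ)) {ι𝕎 : Ginf →* SpR σ}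
    {ωD : Representation ℂ Ginf (SchwartzMap D ℂ)} (hW : IsArchWeilDatum ι𝕎 (repTransport e ωD))
    (Φ : SchwartzMap D ℂ) : Continuous fun g => ωD g Φ := by
  have h : (fun g => ωD g Φ) = fun g => (schwartzTransport e).symm (repTransport e ωD g (schwartzTransport e Φ)) := by
    funext g
    rw [repTransport_apply, ContinuousLinearEquiv.symm_apply_apply, ContinuousLinearEquiv.symm_apply_apply]
  rw [h]
  exact (schwartzTransport e).symm.continuous.comp (hW.continuous_apply _)

omit [DecidableEq σ] in
/-- (w2) on the original carrier: covariance for `rhoSD e`. [folklore] -/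
theorem IsArchWeilDatum.covariant_carrier (e : D ≃L[ℝ] (σ → ℝ)) {ι𝕎 : Ginf →* SpR σ}
    {ωD : Representation ℂ Ginf (SchwartzMap D ℂ)} (hW : IsArchWeilDatum ι𝕎 (repTransport e ωD)) :
    IsPhaseCovariantSD e (fun g => ⇑((ι𝕎 g).1 : (PV σ) ≃ₗ[ℝ] PV σ)) (fun g => ωD g) :=
  (isPhaseCovariantS_opTransport_iff e _ _).1 hW.covariant

end Carrier

/-! ## 7. Junction with the theta kernel: theta majorants of `ω_∞ ⊗ ω_f` -/

section Theta

open NumberField NumberField.mixedEmbedding IsDedekindDomain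
open Literature.NumberTheory.Automorphic

variable {F : Type} [Field F] [NumberField F] {n : ℕ}
variable {Gfin : Type*} [Group Gfin] [TopologicalSpace Gfin] [SeparatelyContinuousMul Gfin]

omit [DecidableEq σ] in
open scoped Classical in
/-- **Theta majorants of `ω_∞ ⊗ ω_f`** for `ω_∞` an archimedean Weil datum (through any linear identification
`e : (F ⊗ ℝ)ⁿ ≃ ℝ^σ`) and `ω_f` smooth: the hypothesis `hω` of `ThetaDualPairDatum.adelicOfDualPairRep`.
[folklore] -/
theorem IsArchWeilDatum.hasThetaMajorants_adelicRep (e : (Fin n → mixedSpace F) ≃L[ℝ] (σ → ℝ))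
    {ι𝕎 : Ginf →* SpR σ} {ωinf : Representation ℂ Ginf 𝓢((Fin n → mixedSpace F), ℂ)}
    (hW : IsArchWeilDatum ι𝕎 (repTransport e ωinf)) (ωfin : Representation ℂ Gfin (FinSB F (Fin n)))
    (hfin : ωfin.IsSmooth) : HasThetaMajorants (F := F) fun g Φ => adelicRep ωinf ωfin g Φ :=
  hasThetaMajorants_adelicRep_of_isSmooth ωinf ωfin (hW.continuous_apply_carrier e) hfin

omit [DecidableEq σ] in
open scoped Classical in
/-- … pulled back along a continuous homomorphism `s : H →* G_∞ × G_f` (the diagonal map of the adelic points of a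
dual pair). [folklore] -/
theorem IsArchWeilDatum.hasThetaMajorants_adelicRep_comp (e : (Fin n → mixedSpace F) ≃L[ℝ] (σ → ℝ))
    {ι𝕎 : Ginf →* SpR σ} {ωinf : Representation ℂ Ginf 𝓢((Fin n → mixedSpace F), ℂ)}
    (hW : IsArchWeilDatum ι𝕎 (repTransport e ωinf)) (ωfin : Representation ℂ Gfin (FinSB F (Fin n)))
    (hfin : ωfin.IsSmooth) {H : Type*} [Monoid H] [TopologicalSpace H] (s : H →* Ginf × Gfin)
    (hs : Continuous s) : HasThetaMajorants (F := F) fun h Φ => (adelicRep ωinf ωfin).comp s h Φ :=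
  (hW.hasThetaMajorants_adelicRep e ωfin hfin).comp hs

omit [DecidableEq σ] in
open scoped Classical in
/-- **Continuity of the theta kernel** `(g_∞, g_f) ↦ Θ(ω(g_∞, g_f)Φ)` for every `Φ ∈ 𝒮(𝔸_Fⁿ)`
(Weil 1964, n° 41, Théorème 6, conclusion 1). [folklore] -/
theorem IsArchWeilDatum.continuous_thetaDistLM_adelicRep (e : (Fin n → mixedSpace F) ≃L[ℝ] (σ → ℝ))
    {ι𝕎 : Ginf →* SpR σ} {ωinf : Representation ℂ Ginf 𝓢((Fin n → mixedSpace F), ℂ)}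
    (hW : IsArchWeilDatum ι𝕎 (repTransport e ωinf)) (ωfin : Representation ℂ Gfin (FinSB F (Fin n)))
    (hfin : ωfin.IsSmooth) (Φ : ↥(piSchwartzBruhat F (Fin n))) :
    Continuous fun g => thetaDistLM F (Fin n) (adelicRep ωinf ωfin g Φ) :=
  (hW.hasThetaMajorants_adelicRep e ωfin hfin).continuous_thetaDistLM Φ

end Theta

/-! ## 8. The sign of the archimedean character: `ρ(p,−q)` and the conjugation `spConj` -/

section Sign

variable (σ)

omit [DecidableEq σ] in
/-- `e^{2πi(−q)·x + πi p·(−q)} = conj (e^{2πi q·x + πi p·q})`: the operators `rhoS p (−q)`,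
`f ↦ e^{−2πi q·x − πi p·q} f(x+p)`, are the Heisenberg operators of the CONJUGATE character `x ↦ e^{−2πix}`.
[folklore] -/
theorem rhoMul_neg_right (p q x : σ → ℝ) : rhoMul p (-q) x = conj (rhoMul p q x) := by
  rw [rhoMul, rhoMul, ← Complex.exp_conj, map_mul, Complex.conj_ofReal, Complex.conj_I, mul_neg, ← neg_mul,
    ← Complex.ofReal_neg]
  congr 3
  simp only [Pi.neg_apply, neg_mul, mul_neg, Finset.sum_neg_distrib]
  ring

omit [Fintype σ] [DecidableEq σ] in
/-- **The anti-symplectic involution `(p,q) ↦ (p,−q)`** of phase space. [folklore] -/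
def qFlip : (PV σ) ≃ₗ[ℝ] PV σ where
  toFun w := (w.1, -w.2)
  invFun w := (w.1, -w.2)
  map_add' w w' := by ext <;> simp [add_comm]
  map_smul' c w := by ext <;> simp
  left_inv w := by simp
  right_inv w := by simp

omit [Fintype σ] [DecidableEq σ] in
/-- Unfolding. [folklore] -/
@[simp] theorem qFlip_apply (w : PV σ) : qFlip σ w = (w.1, -w.2) := rfl

omit [Fintype σ] [DecidableEq σ] in
/-- `qFlip` is an involution. [folklore] -/
@[simp] theorem qFlip_qFlip (w : PV σ) : qFlip σ (qFlip σ w) = w := by simp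

omit [DecidableEq σ] in
/-- `qFlip` is ANTI-symplectic: it negates `p·q′ − p′·q`. [folklore] -/
theorem alt_qFlip (w w' : PV σ) :
    polar (dotPairing σ) (qFlip σ w) (qFlip σ w') - polar (dotPairing σ) (qFlip σ w') (qFlip σ w) =
      -(polar (dotPairing σ) w w' - polar (dotPairing σ) w' w) := by
  simp only [polar_apply, dotPairing_apply, qFlip_apply, dotProduct_neg]
  ring

omit [DecidableEq σ] in
/-- Conjugating a symplectic map by `qFlip` gives a symplectic map. [folklore] -/
theorem qFlip_conj_mem (g : SpR σ) :
    (qFlip σ).trans ((g.1 : (PV σ) ≃ₗ[ℝ] PV σ).trans (qFlip σ)) ∈ symplecticGroup (polar (dotPairing σ)) := by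
  rw [mem_symplecticGroup]
  intro w w'
  have hg := (mem_symplecticGroup _ g.1).1 g.2 (qFlip σ w) (qFlip σ w')
  simp only [LinearEquiv.trans_apply]
  rw [alt_qFlip, hg, alt_qFlip, neg_neg]

omit [DecidableEq σ] in
/-- **Conjugation by `qFlip`** on the symplectic group: `g ↦ (w ↦ qFlip (g (qFlip w)))`. [folklore] -/
def spConj : (SpR σ) →* SpR σ where
  toFun g := ⟨(qFlip σ).trans ((g.1 : (PV σ) ≃ₗ[ℝ] PV σ).trans (qFlip σ)), qFlip_conj_mem σ g⟩
  map_one' := by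
    apply Subtype.ext
    apply LinearEquiv.ext
    intro w
    exact qFlip_qFlip σ w
  map_mul' g g' := by
    apply Subtype.ext
    apply LinearEquiv.ext
    intro w
    show qFlip σ ((g * g').1 (qFlip σ w)) = qFlip σ (g.1 (qFlip σ (qFlip σ (g'.1 (qFlip σ w)))))
    rw [qFlip_qFlip]
    rfl

omit [DecidableEq σ] in
/-- Unfolding: `spConj g w = qFlip (g (qFlip w))`. [folklore] -/
@[simp] theorem spConj_apply (g : SpR σ) (w : PV σ) :
    ((spConj σ g).1 : (PV σ) ≃ₗ[ℝ] PV σ) w = qFlip σ ((g.1 : (PV σ) ≃ₗ[ℝ] PV σ) (qFlip σ w)) := rfl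

omit [DecidableEq σ] in
/-- `spConj` is an involution. [folklore] -/
@[simp] theorem spConj_spConj (g : SpR σ) : spConj σ (spConj σ g) = g := by
  apply Subtype.ext
  apply LinearEquiv.ext
  intro w
  rw [spConj_apply, spConj_apply, qFlip_qFlip, qFlip_qFlip]

variable {σ} {H : Type*}

omit [DecidableEq σ] in
/-- **The dictionary of signs.**  Covariance of a family for the operators `ρ(p,q)` over `spConj ∘ ι` is
covariance for the conjugate-character operators `ρ(p,−q)` over `ι` itself:
`ω(h) ρ(p,−q) = ρ(p′,−q′) ω(h)` with `(p′,q′) = ι(h)(p,q)`.  So the archimedean Weil datum for the character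
`x ↦ e^{−2πix}` over `ι𝕎` is `IsArchWeilDatum (spConj.comp ι𝕎) ω`. [folklore] -/
theorem isPhaseCovariantS_spConj_iff (ι : H → SpR σ) (ωS : H → ((SR σ) →ₗ[ℂ] SR σ)) :
    IsPhaseCovariantS (fun h => ⇑((spConj σ (ι h)).1 : (PV σ) ≃ₗ[ℝ] PV σ)) ωS ↔
      ∀ (h : H) (p q : σ → ℝ) (f : SR σ),
        ωS h (rhoS p (-q) f) =
          rhoS (((ι h).1 : (PV σ) ≃ₗ[ℝ] PV σ) (p, q)).1 (-(((ι h).1 : (PV σ) ≃ₗ[ℝ] PV σ) (p, q)).2) (ωS h f) := by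
  constructor
  · intro hc h p q f
    have h1 := hc h p (-q) f
    simp only [spConj_apply, qFlip_apply, neg_neg] at h1
    exact h1
  · intro hc h p q f
    have h1 := hc h p (-q) f
    simp only [neg_neg] at h1
    simp only [spConj_apply, qFlip_apply]
    exact h1

end Sign

end Literature.NumberTheory.Weil1964
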